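import Mathlib.RingTheory.Trace.Basic
import Mathlib.FieldTheory.Galois.Basic
import Mathlib.RingTheory.TensorProduct.Free
import HarnessLib

/-!
# Crux `FrobeniusLadder.FRationalResolution` (stmt-ResolutionOfSingularities-15317), line `redirect`,
# stub `stub_diagonalizableQuotientResolution` — GALOIS DESCENT OF IDEALS along `B → B ⊗_K K'`
# (generic brick for the Galois route to the isolated TWISTED case)

At an isolated singular point `x` whose étale quotient chart point `w` has a NON-trivial residue extension
`κ(w) ⊋ κ(x)` (the open «twisted» case of the isolated slice; the residue-trivial case is
`…IsolatedQuotientResolutionField.hasResolution_of_isolated_quotient_charts` ✓), one route is: base-change to a finite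
Galois extension `K'/K` splitting the residue data, build the centre on `X_{K'}` (where brick E-k applies at
trivial-residue chart points), and DESCEND it to `X`. The descent step is the classical Galois descent of ideals, in the
exact currency of `…ChartHloc.hloc_of_flat_chart` / `…DescentDatumCentre` (flat chart `C = B ⊗_K K'` over an affine
open `Spec B ↪ X`, centre `J ⊆ C`):

* `sum_map_mul_dualBasis_eq` — the trace identity: for a `K`-basis `e` of `K'` with trace-dual basis `d`,
  `Σ_σ (1 ⊗ σ)((1 ⊗ d_j) · x) = (coordinate_j x) ⊗ 1` for every `x ∈ B ⊗_K K'`;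
* **`eq_map_comap_of_forall_map_mem`** — an ideal `J ⊆ B ⊗_K K'` stable under every Galois twist `1 ⊗ σ` is extended
  from `B`: `J = (J ∩ B) · (B ⊗_K K')`;
* **`map_includeLeft_le_map_includeRight_of_forall_map_mem`** — hence such a `J` carries Grothendieck's descent datum
  `J ⊗ C ≤ C ⊗ J` in `C ⊗_B C` (the hypothesis `hdesc` of `…DescentDatumCentre.hloc_of_flat_chart_of_descent`).

Honest label: generic commutative algebra (no stub closed by name; the consumers — Galois base change of the chart data
and Galois-stability of a symmetric centre — are NOT in the tree). Related tree results (forms, not stable ideals):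
`Literature.FieldTheory.Galois.GaloisDescentLemma.descentEquiv`, `Literature.RingTheory.GaloisAlgebras.GaloisDescentAlgebras`.
No definitions, no named facts, no sorry. [folklore; cite: KMRT1998, (18.1)] [cite: StacksProject, Tag 0CDQ]
-/

noncomputable section

-- single-problem summit: the doubled namespace component is forced
set_option linter.dupNamespace false

open TensorProduct

namespace Summit.ResolutionOfSingularities.ResolutionOfSingularities.Theorems.FRationalResolution.GaloisIdealDescent

variable {K K' B : Type} [Field K] [Field K'] [Algebra K K'] [CommRing B] [Algebra K B]

/-- **The trace identity.** Let `e` be a `K`-basis of the finite Galois extension `K'/K` and `d` its dual basis for the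
trace form. For every `x ∈ B ⊗_K K'` and every index `j`,
`Σ_σ (1 ⊗ σ) ((1 ⊗ d_j) · x) = (j-th coordinate of x in the B-basis 1 ⊗ e) ⊗ 1`.
(Both sides are `B`-linear in `x`; on `x = 1 ⊗ e_i` the left side is `1 ⊗ Tr(d_j e_i) = δ_{ij}`.)
[folklore; cite: KMRT1998, (18.1)] -/
theorem sum_map_mul_dualBasis_eq [FiniteDimensional K K'] [IsGalois K K'] {ι : Type} [Fintype ι] [DecidableEq ι]
    (e : Module.Basis ι K K') (j : ι) (x : B ⊗[K] K') :
    ∑ σ : K' ≃ₐ[K] K', Algebra.TensorProduct.map (AlgHom.id B B) (σ : K' →ₐ[K] K')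
        ((1 : B) ⊗ₜ[K] ((Algebra.traceForm K K').dualBasis (traceForm_nondegenerate K K') e j) * x) =
      algebraMap B (B ⊗[K] K') ((Algebra.TensorProduct.basis B e).coord j x) := by
  classical
  set d : Module.Basis ι K K' := (Algebra.traceForm K K').dualBasis (traceForm_nondegenerate K K') e with hd
  -- both sides as `B`-linear maps
  let f : B ⊗[K] K' →ₗ[B] B ⊗[K] K' :=
    ∑ σ : K' ≃ₐ[K] K', (Algebra.TensorProduct.map (AlgHom.id B B) (σ : K' →ₐ[K] K')).toLinearMap ∘ₗ
      LinearMap.mulLeft B ((1 : B) ⊗ₜ[K] d j)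
  let g : B ⊗[K] K' →ₗ[B] B ⊗[K] K' :=
    Algebra.linearMap B (B ⊗[K] K') ∘ₗ (Algebra.TensorProduct.basis B e).coord j
  have hfg : f = g := by
    refine (Algebra.TensorProduct.basis B e).ext fun i => ?_
    simp only [f, g, LinearMap.coe_comp, Function.comp_apply, LinearMap.coe_sum, Finset.sum_apply,
      LinearMap.mulLeft_apply, AlgHom.toLinearMap_apply, Algebra.linearMap_apply, Module.Basis.coord_apply,
      Module.Basis.repr_self, Finsupp.single_apply]
    rw [Algebra.TensorProduct.basis_apply]
    have hmul : ((1 : B) ⊗ₜ[K] d j) * ((1 : B) ⊗ₜ[K] e i) = (1 : B) ⊗ₜ[K] (d j * e i) := by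
      rw [Algebra.TensorProduct.tmul_mul_tmul, one_mul]
    simp only [hmul, Algebra.TensorProduct.map_tmul, AlgHom.id_apply, AlgEquiv.coe_toAlgHom]
    rw [← TensorProduct.tmul_sum, ← trace_eq_sum_automorphisms, ← Algebra.traceForm_apply, hd,
      LinearMap.BilinForm.apply_dualBasis_left, Algebra.TensorProduct.algebraMap_apply, Algebra.algebraMap_self,
      RingHom.id_apply]
    split_ifs with h
    · rw [map_one]
    · rw [map_zero, TensorProduct.tmul_zero, TensorProduct.zero_tmul]
  have := congrArg (fun φ : B ⊗[K] K' →ₗ[B] B ⊗[K] K' => φ x) hfg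
  simpa only [f, g, LinearMap.coe_comp, Function.comp_apply, LinearMap.coe_sum, Finset.sum_apply,
    LinearMap.mulLeft_apply, AlgHom.toLinearMap_apply, Algebra.linearMap_apply] using this

/-- **GALOIS DESCENT OF IDEALS.** Let `K'/K` be finite Galois and `B` a commutative `K`-algebra. An ideal `J` of
`B ⊗_K K'` which is stable under every Galois twist `1 ⊗ σ` (`σ ∈ Gal(K'/K)`) is extended from `B`:
`J = (J ∩ B)(B ⊗_K K')`. (For `x ∈ J` each coordinate `b_j` of `x = Σ_j b_j ⊗ e_j` satisfies
`b_j ⊗ 1 = Σ_σ (1 ⊗ σ)((1 ⊗ d_j) x) ∈ J`.) [folklore; cite: KMRT1998, (18.1)] [cite: StacksProject, Tag 0CDQ] -/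
theorem eq_map_comap_of_forall_map_mem [FiniteDimensional K K'] [IsGalois K K'] (J : Ideal (B ⊗[K] K'))
    (hJ : ∀ σ : K' ≃ₐ[K] K', ∀ x ∈ J, Algebra.TensorProduct.map (AlgHom.id B B) (σ : K' →ₐ[K] K') x ∈ J) :
    J = (J.comap (algebraMap B (B ⊗[K] K'))).map (algebraMap B (B ⊗[K] K')) := by
  classical
  refine le_antisymm ?_ Ideal.map_comap_le
  intro x hx
  set e := Module.finBasis K K' with he
  set bB := Algebra.TensorProduct.basis B e with hbB
  -- every coordinate of `x` lies in `J ∩ B`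
  have hcoord : ∀ j, bB.coord j x ∈ J.comap (algebraMap B (B ⊗[K] K')) := by
    intro j
    rw [Ideal.mem_comap, hbB, ← sum_map_mul_dualBasis_eq e j x]
    exact Ideal.sum_mem _ fun σ _ => hJ σ _ (Ideal.mul_mem_left _ _ hx)
  -- `x = Σ_j (coord_j x) • (1 ⊗ e_j)`
  rw [← bB.sum_repr x]
  refine Ideal.sum_mem _ fun j _ => ?_
  rw [Algebra.smul_def]
  exact Ideal.mul_mem_right _ _ (Ideal.mem_map_of_mem _ (hcoord j))

/-- **Galois-stable ideals carry the descent datum.** With `C := B ⊗_K K'` (`K'/K` finite Galois), an ideal `J ⊆ C`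
stable under every `1 ⊗ σ` satisfies `J.map includeLeft ≤ J.map includeRight` in `C ⊗_B C` — the hypothesis
`hdesc` of `…DescentDatumCentre.hloc_of_flat_chart_of_descent` / `hasResolution_of_flat_charts_of_descent`
(indeed both sides equal the extension of `J ∩ B`). [folklore; cite: StacksProject, Tag 0245; Tag 0CDQ] -/
theorem map_includeLeft_le_map_includeRight_of_forall_map_mem [FiniteDimensional K K'] [IsGalois K K']
    (J : Ideal (B ⊗[K] K'))
    (hJ : ∀ σ : K' ≃ₐ[K] K', ∀ x ∈ J, Algebra.TensorProduct.map (AlgHom.id B B) (σ : K' →ₐ[K] K') x ∈ J) :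
    J.map (Algebra.TensorProduct.includeLeft : B ⊗[K] K' →ₐ[B] (B ⊗[K] K') ⊗[B] (B ⊗[K] K')) ≤
      J.map (Algebra.TensorProduct.includeRight : B ⊗[K] K' →ₐ[B] (B ⊗[K] K') ⊗[B] (B ⊗[K] K')) := by
  set I := J.comap (algebraMap B (B ⊗[K] K')) with hI
  have hJI : J = I.map (algebraMap B (B ⊗[K] K')) := eq_map_comap_of_forall_map_mem J hJ
  have hL : J.map (Algebra.TensorProduct.includeLeft : B ⊗[K] K' →ₐ[B] (B ⊗[K] K') ⊗[B] (B ⊗[K] K')) =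
      I.map (algebraMap B ((B ⊗[K] K') ⊗[B] (B ⊗[K] K'))) := by
    rw [hJI]
    change Ideal.map (Algebra.TensorProduct.includeLeft : B ⊗[K] K' →ₐ[B] (B ⊗[K] K') ⊗[B] (B ⊗[K] K')).toRingHom
      (Ideal.map (algebraMap B (B ⊗[K] K')) I) = _
    rw [Ideal.map_map]
    exact congrArg (Ideal.map · I) (RingHom.ext fun b => by simp)
  have hR : J.map (Algebra.TensorProduct.includeRight : B ⊗[K] K' →ₐ[B] (B ⊗[K] K') ⊗[B] (B ⊗[K] K')) =
      I.map (algebraMap B ((B ⊗[K] K') ⊗[B] (B ⊗[K] K'))) := by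
    rw [hJI]
    change Ideal.map (Algebra.TensorProduct.includeRight : B ⊗[K] K' →ₐ[B] (B ⊗[K] K') ⊗[B] (B ⊗[K] K')).toRingHom
      (Ideal.map (algebraMap B (B ⊗[K] K')) I) = _
    rw [Ideal.map_map]
    exact congrArg (Ideal.map · I) (RingHom.ext fun b => by simp)
  rw [hL, hR]

end Summit.ResolutionOfSingularities.ResolutionOfSingularities.Theorems.FRationalResolution.GaloisIdealDescent

end
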